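import Mathlib
import HarnessLib
import Summits.HubbardSuperconductivity.HubbardSuperconductivity.Theorems.KLProgrammeC4aRadialRowsTwoThree

/-!
# Route `KLProgramme` — crux C4a, (L3) for the pp and ph-exchange classes with EVERY geometric input discharged: the `CoMovingJetsL1 4`
# dominators from the bubble's inverse-power majorant ALONE

Cell `gate-hubbard-kl`, lane hubbard-kl-c4a-1 (g5); helper for stub (C) `stub_twoLeg_curvature` of the engine-flow child `KLRegimeEngineV17F2`
(stmt-HubbardSuperconductivity-20437); memo HOME/hubbard-kl-c4a-1/C4A-PLAN.md §22.7.  `…C4aPairSumJetsL1` / `…C4aPairDiffJetsL1` assembled the (L3) dominators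
modulo the chart's radial rows of orders 2 and 3; `…C4aRadialRowsTwoThree` proved those rows (`norm_iteratedDeriv_two/three_levelPoint_sub_le`).  Here they are
plugged in: the ONLY remaining hypothesis besides the frame's sizes is the analytic majorant of the bubble `B` — `B ∈ C⁴`, `‖B‖ ≤ Cb0`,
`‖DᵏB(p)‖ ≤ Cb·(max(c′‖p‖, Λ)^k)⁻¹` (`1 ≤ k ≤ 4`) — S3's deliverable for the above-scale pp / ph bubbles of `𝒱_n`'s second-order part.

* **`coMovingJetsL1_pairSum_of_inversePower'`** (`V(k,q) = B(k+q)`), **`coMovingJetsL1_pairDiff_of_inversePower'`** (`V(k,q) = B(k−q)`):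
  `CoMovingJetsL1 4 (fun i _ => ppJetDominator Cb Cb0 x Λ (2·msD A₃ A₄ 4) i) r μ K V` with the constant `x` built from `radialRowOneConst`, `uRowTwoConst`,
  `uRowThreeConst`, `msD A₃ A₄ 2..4`, `c′` and `pairSumLowerConst r`.

Composition only; nothing about the Hubbard model's sizes; nothing asserts superconductivity.
References: FST II CPAM 51 (1998) §3 Thm 3.5; BGM 2006 §2.4 (2.36)–(2.41) [cite: BenfattoGiulianiMastropietro2006].
-/

noncomputable section

namespace Summit.HubbardSuperconductivity.HubbardSuperconductivity.Theorems.C4a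

set_option linter.dupNamespace false -- summit = problem name (single-conjunct summit), D-0017

open Real Set MeasureTheory Finset
open scoped ContDiff
open Literature.MathematicalPhysics.QuantumLattice Literature.MathematicalPhysics.QuantumLattice.BandSectorCounting Literature.Probability.LatticeModels
open Summit.HubbardSuperconductivity.HubbardSuperconductivity.Theorems.KLRegimeSplit
open Summit.HubbardSuperconductivity.HubbardSuperconductivity.Theorems.DispersionFlow
open Summit.HubbardSuperconductivity.HubbardSuperconductivity.Theorems.PerturbedFermiCurve

section Sizes

variable {K : TrigPolyC4v} {A : ℝ} (hA : ∀ p : Momentum, ∀ j ≤ 2, ‖iteratedFDeriv ℝ j (frameShift K) p‖ ≤ A) (hA20 : A ≤ 1 / 20)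
  (hd : klCurveD ≤ (bandBounds (show (-4 : ℝ) < -1.1 by norm_num) (show (-1.1 : ℝ) ≤ -0.1 by norm_num)
    (show (-0.1 : ℝ) < 0 by norm_num)).Dtmin - 2 * A)
  {μ r : ℝ} (hr : 0 < r) (hlo : (-1.1 : ℝ) < μ - r - A) (hhi : μ + r + A < -0.1)
  {A₃ A₄ : ℝ} (hA₃ : ∀ p : Momentum, ‖iteratedFDeriv ℝ 3 (frameShift K) p‖ ≤ A₃)
  (hA₄ : ∀ p : Momentum, ‖iteratedFDeriv ℝ 4 (frameShift K) p‖ ≤ A₄)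
include hA hA20 hd hr hlo hhi hA₃ hA₄


/-- **(L3) FOR THE pp CLASS, GEOMETRY FULLY DISCHARGED**: for `B : Momentum → ℂ` of class `C⁴` with `‖B‖ ≤ Cb0` and the inverse-power majorant
`‖DᵏB(p)‖ ≤ Cb·(max(c′‖p‖, Λ)^k)⁻¹` (`1 ≤ k ≤ 4`; `0 ≤ Cb`, `0 < c′, Λ`): `CoMovingJetsL1 4 (fun i _ => ppJetDominator Cb Cb0 x Λ (2·msD A₃ A₄ 4) i) r μ K
(fun k q => B(k+q))` with the radial rows of orders 2, 3 instantiated by `curveRowTwo/ThreeConst`. [cite: BenfattoGiulianiMastropietro2006, §2.4 (2.36)–(2.41)] -/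
theorem coMovingJetsL1_pairSum_of_inversePower' {Bf : Momentum → ℂ} (hB : ContDiff ℝ 4 Bf) {Cb Cb0 c' Λ : ℝ} (hCb : 0 ≤ Cb) (hc' : 0 < c')
    (hΛ : 0 < Λ) (hBk : ∀ p : Momentum, ∀ k, 1 ≤ k → k ≤ 4 → ‖iteratedFDeriv ℝ k Bf p‖ ≤ Cb * ((max (c' * ‖p‖) Λ) ^ k)⁻¹)
    (hB0 : ∀ p : Momentum, ‖Bf p‖ ≤ Cb0) :
    CoMovingJetsL1 4
      (fun i _ => ppJetDominator Cb Cb0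
        (max (max (radialRowOneConst A ((bandBounds (show (-4 : ℝ) < -1.1 by norm_num) (show (-1.1 : ℝ) ≤ -0.1 by norm_num)
            (show (-0.1 : ℝ) < 0 by norm_num)).Dtmin - 2 * A)) (msD A₃ A₄ 2))
          (max (max (uRowTwoConst A A₃ ((bandBounds (show (-4 : ℝ) < -1.1 by norm_num) (show (-1.1 : ℝ) ≤ -0.1 by norm_num)
              (show (-0.1 : ℝ) < 0 by norm_num)).Dtmin - 2 * A) +
            1 / ((bandBounds (show (-4 : ℝ) < -1.1 by norm_num) (show (-1.1 : ℝ) ≤ -0.1 by norm_num) (show (-0.1 : ℝ) < 0 by norm_num)).Dtmin -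
              2 * A) +
            2 * (radialRowOneConst A ((bandBounds (show (-4 : ℝ) < -1.1 by norm_num) (show (-1.1 : ℝ) ≤ -0.1 by norm_num)
              (show (-0.1 : ℝ) < 0 by norm_num)).Dtmin - 2 * A) -
              1 / ((bandBounds (show (-4 : ℝ) < -1.1 by norm_num) (show (-1.1 : ℝ) ≤ -0.1 by norm_num) (show (-0.1 : ℝ) < 0 by norm_num)).Dtmin -
                2 * A))) (msD A₃ A₄ 3))
            (max (uRowThreeConst A A₃ A₄ ((bandBounds (show (-4 : ℝ) < -1.1 by norm_num) (show (-1.1 : ℝ) ≤ -0.1 by norm_num)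
                (show (-0.1 : ℝ) < 0 by norm_num)).Dtmin - 2 * A) +
              3 * (radialRowOneConst A ((bandBounds (show (-4 : ℝ) < -1.1 by norm_num) (show (-1.1 : ℝ) ≤ -0.1 by norm_num)
                (show (-0.1 : ℝ) < 0 by norm_num)).Dtmin - 2 * A) -
                1 / ((bandBounds (show (-4 : ℝ) < -1.1 by norm_num) (show (-1.1 : ℝ) ≤ -0.1 by norm_num) (show (-0.1 : ℝ) < 0 by norm_num)).Dtmin -
                  2 * A)) +
              3 * uRowTwoConst A A₃ ((bandBounds (show (-4 : ℝ) < -1.1 by norm_num) (show (-1.1 : ℝ) ≤ -0.1 by norm_num)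
                (show (-0.1 : ℝ) < 0 by norm_num)).Dtmin - 2 * A) +
              1 / ((bandBounds (show (-4 : ℝ) < -1.1 by norm_num) (show (-1.1 : ℝ) ≤ -0.1 by norm_num) (show (-0.1 : ℝ) < 0 by norm_num)).Dtmin -
                2 * A)) (msD A₃ A₄ 4))) /
          (c' * pairSumLowerConst r)) Λ (2 * msD A₃ A₄ 4) i)
      r μ K (fun k q => Bf (k + q)) := by
  have hrow₂ := fun ρ (hρ : |ρ| < r) s => norm_iteratedDeriv_two_levelPoint_sub_le hA hA20 hd hr hlo hhi hA₃ hA₄ hρ s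
  have hrow₃ := fun ρ (hρ : |ρ| < r) s => norm_iteratedDeriv_three_levelPoint_sub_le hA hA20 hd hr hlo hhi hA₃ hA₄ hρ s
  have hr2 : |r / 2| < r := by rw [abs_of_pos (by positivity)]; linarith
  have hL₂ : 0 ≤ uRowTwoConst A A₃ ((bandBounds (show (-4 : ℝ) < -1.1 by norm_num) (show (-1.1 : ℝ) ≤ -0.1 by norm_num)
        (show (-0.1 : ℝ) < 0 by norm_num)).Dtmin - 2 * A) +
      1 / ((bandBounds (show (-4 : ℝ) < -1.1 by norm_num) (show (-1.1 : ℝ) ≤ -0.1 by norm_num) (show (-0.1 : ℝ) < 0 by norm_num)).Dtmin - 2 * A) +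
      2 * (radialRowOneConst A ((bandBounds (show (-4 : ℝ) < -1.1 by norm_num) (show (-1.1 : ℝ) ≤ -0.1 by norm_num)
        (show (-0.1 : ℝ) < 0 by norm_num)).Dtmin - 2 * A) -
        1 / ((bandBounds (show (-4 : ℝ) < -1.1 by norm_num) (show (-1.1 : ℝ) ≤ -0.1 by norm_num) (show (-0.1 : ℝ) < 0 by norm_num)).Dtmin -
          2 * A)) := by
    have h := (norm_nonneg _).trans (hrow₂ (r / 2) hr2 0)
    have hpos : 0 < |r / 2| := by rw [abs_of_pos (by positivity)]; positivity
    exact le_of_mul_le_mul_right (by rwa [zero_mul]) hpos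
  exact coMovingJetsL1_pairSum_of_inversePower hA hA20 hd hr hlo hhi hA₃ hA₄ hB hCb hc' hΛ hL₂ hBk hB0 hrow₂ hrow₃

/-- **(L3) FOR THE ph-EXCHANGE CLASS, GEOMETRY FULLY DISCHARGED** (twin). [cite: BenfattoGiulianiMastropietro2006, §2.4 (2.36)–(2.41)] -/
theorem coMovingJetsL1_pairDiff_of_inversePower' {Bf : Momentum → ℂ} (hB : ContDiff ℝ 4 Bf) {Cb Cb0 c' Λ : ℝ} (hCb : 0 ≤ Cb) (hc' : 0 < c')
    (hΛ : 0 < Λ) (hBk : ∀ p : Momentum, ∀ k, 1 ≤ k → k ≤ 4 → ‖iteratedFDeriv ℝ k Bf p‖ ≤ Cb * ((max (c' * ‖p‖) Λ) ^ k)⁻¹)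
    (hB0 : ∀ p : Momentum, ‖Bf p‖ ≤ Cb0) :
    CoMovingJetsL1 4
      (fun i _ => ppJetDominator Cb Cb0
        (max (max (radialRowOneConst A ((bandBounds (show (-4 : ℝ) < -1.1 by norm_num) (show (-1.1 : ℝ) ≤ -0.1 by norm_num)
            (show (-0.1 : ℝ) < 0 by norm_num)).Dtmin - 2 * A)) (msD A₃ A₄ 2))
          (max (max (uRowTwoConst A A₃ ((bandBounds (show (-4 : ℝ) < -1.1 by norm_num) (show (-1.1 : ℝ) ≤ -0.1 by norm_num)
              (show (-0.1 : ℝ) < 0 by norm_num)).Dtmin - 2 * A) +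
            1 / ((bandBounds (show (-4 : ℝ) < -1.1 by norm_num) (show (-1.1 : ℝ) ≤ -0.1 by norm_num) (show (-0.1 : ℝ) < 0 by norm_num)).Dtmin -
              2 * A) +
            2 * (radialRowOneConst A ((bandBounds (show (-4 : ℝ) < -1.1 by norm_num) (show (-1.1 : ℝ) ≤ -0.1 by norm_num)
              (show (-0.1 : ℝ) < 0 by norm_num)).Dtmin - 2 * A) -
              1 / ((bandBounds (show (-4 : ℝ) < -1.1 by norm_num) (show (-1.1 : ℝ) ≤ -0.1 by norm_num) (show (-0.1 : ℝ) < 0 by norm_num)).Dtmin -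
                2 * A))) (msD A₃ A₄ 3))
            (max (uRowThreeConst A A₃ A₄ ((bandBounds (show (-4 : ℝ) < -1.1 by norm_num) (show (-1.1 : ℝ) ≤ -0.1 by norm_num)
                (show (-0.1 : ℝ) < 0 by norm_num)).Dtmin - 2 * A) +
              3 * (radialRowOneConst A ((bandBounds (show (-4 : ℝ) < -1.1 by norm_num) (show (-1.1 : ℝ) ≤ -0.1 by norm_num)
                (show (-0.1 : ℝ) < 0 by norm_num)).Dtmin - 2 * A) -
                1 / ((bandBounds (show (-4 : ℝ) < -1.1 by norm_num) (show (-1.1 : ℝ) ≤ -0.1 by norm_num) (show (-0.1 : ℝ) < 0 by norm_num)).Dtmin -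
                  2 * A)) +
              3 * uRowTwoConst A A₃ ((bandBounds (show (-4 : ℝ) < -1.1 by norm_num) (show (-1.1 : ℝ) ≤ -0.1 by norm_num)
                (show (-0.1 : ℝ) < 0 by norm_num)).Dtmin - 2 * A) +
              1 / ((bandBounds (show (-4 : ℝ) < -1.1 by norm_num) (show (-1.1 : ℝ) ≤ -0.1 by norm_num) (show (-0.1 : ℝ) < 0 by norm_num)).Dtmin -
                2 * A)) (msD A₃ A₄ 4))) /
          (c' * pairSumLowerConst r)) Λ (2 * msD A₃ A₄ 4) i)
      r μ K (fun k q => Bf (k - q)) := by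
  have hrow₂ := fun ρ (hρ : |ρ| < r) s => norm_iteratedDeriv_two_levelPoint_sub_le hA hA20 hd hr hlo hhi hA₃ hA₄ hρ s
  have hrow₃ := fun ρ (hρ : |ρ| < r) s => norm_iteratedDeriv_three_levelPoint_sub_le hA hA20 hd hr hlo hhi hA₃ hA₄ hρ s
  have hr2 : |r / 2| < r := by rw [abs_of_pos (by positivity)]; linarith
  have hL₂ : 0 ≤ uRowTwoConst A A₃ ((bandBounds (show (-4 : ℝ) < -1.1 by norm_num) (show (-1.1 : ℝ) ≤ -0.1 by norm_num)
        (show (-0.1 : ℝ) < 0 by norm_num)).Dtmin - 2 * A) +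
      1 / ((bandBounds (show (-4 : ℝ) < -1.1 by norm_num) (show (-1.1 : ℝ) ≤ -0.1 by norm_num) (show (-0.1 : ℝ) < 0 by norm_num)).Dtmin - 2 * A) +
      2 * (radialRowOneConst A ((bandBounds (show (-4 : ℝ) < -1.1 by norm_num) (show (-1.1 : ℝ) ≤ -0.1 by norm_num)
        (show (-0.1 : ℝ) < 0 by norm_num)).Dtmin - 2 * A) -
        1 / ((bandBounds (show (-4 : ℝ) < -1.1 by norm_num) (show (-1.1 : ℝ) ≤ -0.1 by norm_num) (show (-0.1 : ℝ) < 0 by norm_num)).Dtmin -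
          2 * A)) := by
    have h := (norm_nonneg _).trans (hrow₂ (r / 2) hr2 0)
    have hpos : 0 < |r / 2| := by rw [abs_of_pos (by positivity)]; positivity
    exact le_of_mul_le_mul_right (by rwa [zero_mul]) hpos
  exact coMovingJetsL1_pairDiff_of_inversePower hA hA20 hd hr hlo hhi hA₃ hA₄ hB hCb hc' hΛ hL₂ hBk hB0 hrow₂ hrow₃

end Sizes

end Summit.HubbardSuperconductivity.HubbardSuperconductivity.Theorems.C4a

end
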